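import Literature.NumberTheory.LFunctions.DirichletPolynomialDiscreteMeanValue
import Mathlib.Algebra.Order.Chebyshev
import Mathlib.Data.Nat.Log
import HarnessLib

/-!
# Ivić's discrete mean value theorem for Dirichlet polynomials (Thm 5.3) — proof

Trunk T-ANT, topic `Literature/NumberTheory/LFunctions`.  This file DISCHARGES the named fact
`Literature.NumberTheory.LFunctions.Ivic1985_theorem53` of `DirichletPolynomialMeanValue.lean`
(Ivić 1985, Thm 5.3, (5.14)): for `N ≥ 2`, `T ≥ 1`, a finite set `𝒯 ⊂ [1, T]` of reals pairwise
`≥ 1` apart and arbitrary complex `a_n`,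

  `∑_{t ∈ 𝒯} |∑_{n ≤ N} a_n n^{-it}|² ≤ 324 (T ∑_{n ≤ N} |a_n|² + ∑_{n ≤ N} n |a_n|²) log N`.

## The argument

Ivić's printed proof ((5.15)–(5.18)) combines Gallagher's window inequality
`|f(t_r)| ≤ ∫_{t_r-1/2}^{t_r+1/2} (|f| + |f'|)`, `f = A²`, with the *sharp* integral mean value
theorem (his Thm 5.2, Montgomery–Vaughan: `∫_0^T |A|² = T ∑|a_n|² + O(∑ n|a_n|²)`), which the tree
holds only as a named fact (`Ivic1985_theorem52`).  The tree's PROVED integral mean value theorem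
is the weak one, `∫_{-T}^{T} |A|² ≤ (5T + 18N) ∑ |a_n|²`
(`Literature.NumberTheory.LFunctions.dirichletPolynomial_meanSquare_le`), and with it the printed
argument only yields `≪ (T + N) log N ∑|a_n|²` (the tree's
`Literature.NumberTheory.LFunctions.sum_norm_sq_dirichletPoly_le`), which does not imply (5.14)
(`N ∑|a_n|²` versus `∑ n|a_n|²`).  We nevertheless obtain (5.14) exactly as printed, from the weak
theorem, by spending the factor `log N` differently:

* **Log-free block estimate** (`sum_norm_sq_dirichletPoly_le_of_abs_log_sub_le`): if all
  frequencies `log n` in the support of `b` lie within `1` of some `c ∈ ℝ`, then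
  `∑_{t ∈ 𝒯} |B(t)|² ≤ (30T + 54N) ∑ |b_n|²` — Gallagher's inequality is applied to `f = E²` with the
  carrier removed, `E(x) = e^{icx} B(x)`, whose derivative `E' = e^{icx} · ∑ b_n i(c - log n) n^{-ix}`
  is again a Dirichlet polynomial with coefficients of modulus `≤ |b_n|`; then `2|E||E'| ≤ |E|² + |E'|²`,
  the disjoint windows, and the weak mean value theorem twice on `(-(T+1), T+1)`.
* **Dyadic decomposition**: `A = ∑_{k ≤ K} A_k`, `A_k` the piece `2^k ≤ n < 2^{k+1}`, `K = ⌊log₂ N⌋`;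
  Cauchy–Schwarz gives `|A|² ≤ (K+1) ∑_k |A_k|²`, the block estimate with `c = log 2^k` and length
  `min(N, 2^{k+1} - 1) ≤ 2n` gives `∑_t |A_k(t)|² ≤ ∑_{2^k ≤ n < 2^{k+1}} (30T + 108n)|a_n|²`, and
  `K + 1 ≤ 2 log N / log 2 ≤ 3 log N` for `N ≥ 2`.  Hence the constant `3 · 108 = 324`.

## Main results

* `Literature.NumberTheory.LFunctions.sum_norm_sq_dirichletPoly_le_of_abs_log_sub_le` — the
  log-free discrete mean value theorem for a narrow band of frequencies (PROVED).
* `Literature.NumberTheory.LFunctions.sum_norm_sq_dirichletPoly_le_ivic` — Ivić (5.14) with the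
  explicit constant `324`, for `𝒯 ⊂ [-T, T]` (PROVED).
* `Literature.NumberTheory.LFunctions.Ivic1985_theorem53_holds : Ivic1985_theorem53` (PROVED).

## References

* A. Ivić, *The Riemann Zeta-Function*, Wiley 1985 (Dover 2003), Ch. 5, Thm 5.3, (5.14)–(5.18),
  p. 134.
* P. X. Gallagher, *A large sieve density estimate near σ = 1*, Invent. Math. 11 (1970), Lemma 1.
-/

noncomputable section

open Finset Real MeasureTheory Complex Set intervalIntegral

namespace Literature.NumberTheory.LFunctions

/-! ### The carrier `x ↦ e^{icx}` -/

/-- `d/dx e^{icx} = e^{icx} · ic` for real `c`, as a function of the real variable `x`. [folklore] -/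
theorem hasDerivAt_cexp_carrier (c x : ℝ) :
    HasDerivAt (fun y : ℝ ↦ cexp ((c : ℂ) * (y : ℂ) * I))
      (cexp ((c : ℂ) * (x : ℂ) * I) * ((c : ℂ) * I)) x := by
  have h1 : HasDerivAt (fun w : ℂ ↦ cexp ((c : ℂ) * w * I))
      (cexp ((c : ℂ) * (x : ℂ) * I) * ((c : ℂ) * 1 * I)) (x : ℂ) :=
    (((hasDerivAt_id (x : ℂ)).const_mul (c : ℂ)).mul_const I).cexp
  exact h1.comp_ofReal.congr_deriv (by ring)

/-- `|e^{icx}| = 1`. [folklore] -/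
theorem norm_cexp_carrier (c x : ℝ) : ‖cexp ((c : ℂ) * (x : ℂ) * I)‖ = 1 := by
  rw [← Complex.ofReal_mul]
  exact Complex.norm_exp_ofReal_mul_I _

/-! ### A log-free discrete mean value theorem for a narrow band of frequencies -/

/-- **Discrete mean value theorem for a narrow band of frequencies, no logarithm** (PROVED): let
`T ≥ 1`, let `𝒯 ⊂ [-T, T]` be a finite set of reals pairwise `≥ 1` apart, and let `b_1, …, b_N` be
complex numbers such that `|log n - c| ≤ 1` whenever `b_n ≠ 0`, for some fixed real `c`.  Then
`∑_{t ∈ 𝒯} |∑_{n ≤ N} b_n n^{-it}|² ≤ (30T + 54N) ∑_{n ≤ N} |b_n|²`.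
Proof: Gallagher's window inequality (`norm_le_integral_add_integral_deriv`) for `f = E²`,
`E(x) = e^{icx} ∑ b_n n^{-ix}`, `E'(x) = e^{icx} ∑ b_n i(c - log n) n^{-ix}`; `2|E||E'| ≤ |E|² + |E'|²`;
disjoint windows (`sum_integral_window_le`); and the weak integral mean value theorem
`dirichletPolynomial_meanSquare_le` on `(-(T+1), T+1)` for the coefficients `b_n` and
`b_n i(c - log n)` (of modulus `≤ |b_n|`): `3 (5(T+1) + 18N) ≤ 30T + 54N`.
[cite: Ivic1985, proof of Theorem 5.3, (5.15)–(5.18)] -/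
theorem sum_norm_sq_dirichletPoly_le_of_abs_log_sub_le (N : ℕ) (b : ℕ → ℂ) (c : ℝ)
    (hc : ∀ n ∈ Finset.Icc 1 N, b n ≠ 0 → |Real.log n - c| ≤ 1)
    {T : ℝ} (hT : 1 ≤ T) (𝒯 : Finset ℝ) (h𝒯 : ∀ t ∈ 𝒯, |t| ≤ T)
    (hsep : ∀ t ∈ 𝒯, ∀ t' ∈ 𝒯, t ≠ t' → 1 ≤ |t - t'|) :
    ∑ t ∈ 𝒯, ‖∑ n ∈ Finset.Icc 1 N, b n * (n : ℂ) ^ (-((t : ℂ) * I))‖ ^ 2 ≤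
      (30 * T + 54 * N) * ∑ n ∈ Finset.Icc 1 N, ‖b n‖ ^ 2 := by
  -- notation
  set A : ℝ → ℂ := fun t ↦ ∑ n ∈ Finset.Icc 1 N, b n * (n : ℂ) ^ (-((t : ℂ) * I)) with hA
  set d : ℕ → ℂ := fun n ↦ b n * (-(Real.log n : ℂ) * I) with hd
  set B : ℝ → ℂ := fun t ↦ ∑ n ∈ Finset.Icc 1 N, d n * (n : ℂ) ^ (-((t : ℂ) * I)) with hB
  set b' : ℕ → ℂ := fun n ↦ b n * (((c - Real.log n : ℝ) : ℂ) * I) with hb'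
  set Q : ℝ → ℂ := fun t ↦ ∑ n ∈ Finset.Icc 1 N, b' n * (n : ℂ) ^ (-((t : ℂ) * I)) with hQ
  set e : ℝ → ℂ := fun t ↦ cexp ((c : ℂ) * (t : ℂ) * I) with he
  set E : ℝ → ℂ := fun t ↦ e t * A t with hE
  set E' : ℝ → ℂ := fun t ↦ e t * ((c : ℂ) * I) * A t + e t * B t with hE'
  set S : ℝ := ∑ n ∈ Finset.Icc 1 N, ‖b n‖ ^ 2 with hS
  set M : ℝ := 5 * (T + 1) + 18 * N with hM
  have hS0 : 0 ≤ S := Finset.sum_nonneg fun n _ ↦ by positivity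
  have hT1 : 0 < T + 1 := by linarith
  have hM0 : 0 < M := by rw [hM]; positivity
  have he1 : ∀ t, ‖e t‖ = 1 := fun t ↦ norm_cexp_carrier c t
  -- continuity and derivatives
  have hcA : Continuous A := DirichletPolynomialDiscreteMeanValue.continuous_dirichletPoly b N
  have hcB : Continuous B := DirichletPolynomialDiscreteMeanValue.continuous_dirichletPoly d N
  have hcQ : Continuous Q := DirichletPolynomialDiscreteMeanValue.continuous_dirichletPoly b' N
  have hce : Continuous e := by rw [he]; fun_prop
  have hcE : Continuous E := hce.mul hcA
  have hcE' : Continuous E' := ((hce.mul continuous_const).mul hcA).add (hce.mul hcB)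
  have hdA : ∀ t, HasDerivAt A (B t) t := fun t ↦ hasDerivAt_dirichletPoly b N t
  have hde : ∀ t, HasDerivAt e (e t * ((c : ℂ) * I)) t := fun t ↦ hasDerivAt_cexp_carrier c t
  have hdE : ∀ t, HasDerivAt E (E' t) t := fun t ↦ (hde t).mul (hdA t)
  have hdF : ∀ t, HasDerivAt (fun y ↦ E y * E y) (E' t * E t + E t * E' t) t :=
    fun t ↦ (hdE t).mul (hdE t)
  have hcF' : Continuous fun t ↦ E' t * E t + E t * E' t := (hcE'.mul hcE).add (hcE.mul hcE')
  -- removing the carrier: `E' = e · Q`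
  have hE'Q : ∀ t, E' t = e t * Q t := by
    intro t
    simp only [hE', hQ, hB, hA, hb', hd]
    rw [mul_assoc, ← mul_add, Finset.mul_sum, ← Finset.sum_add_distrib]
    congr 1
    refine Finset.sum_congr rfl fun n _ ↦ ?_
    push_cast
    ring
  have hEE : ∀ u, ‖E u * E u‖ = ‖A u‖ ^ 2 := by
    intro u
    simp only [hE, norm_mul, he1, one_mul, sq]
  have hF' : ∀ u, ‖E' u * E u + E u * E' u‖ ≤ ‖A u‖ ^ 2 + ‖Q u‖ ^ 2 := by
    intro u
    rw [hE'Q]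
    simp only [hE]
    calc ‖e u * Q u * (e u * A u) + e u * A u * (e u * Q u)‖
        ≤ ‖e u * Q u * (e u * A u)‖ + ‖e u * A u * (e u * Q u)‖ := norm_add_le _ _
      _ = 2 * ‖A u‖ * ‖Q u‖ := by simp only [norm_mul, he1]; ring
      _ ≤ ‖A u‖ ^ 2 + ‖Q u‖ ^ 2 := two_mul_le_add_sq _ _
  -- Gallagher on each window, then `2|A||Q| ≤ |A|² + |Q|²`
  have hG : ∀ t : ℝ, ‖A t‖ ^ 2 ≤ 2 * (∫ u in (t - 1 / 2)..(t + 1 / 2), ‖A u‖ ^ 2) +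
      ∫ u in (t - 1 / 2)..(t + 1 / 2), ‖Q u‖ ^ 2 := by
    intro t
    have h1 := norm_le_integral_add_integral_deriv hdF hcF' t
    have h2 : ∫ u in (t - 1 / 2)..(t + 1 / 2), ‖E' u * E u + E u * E' u‖ ≤
        ∫ u in (t - 1 / 2)..(t + 1 / 2), (‖A u‖ ^ 2 + ‖Q u‖ ^ 2) :=
      integral_mono_on (by linarith) (hcF'.norm.intervalIntegrable _ _)
        (((hcA.norm.pow 2).add (hcQ.norm.pow 2)).intervalIntegrable _ _) fun u _ ↦ hF' u
    have h3 : ∫ u in (t - 1 / 2)..(t + 1 / 2), (‖A u‖ ^ 2 + ‖Q u‖ ^ 2) =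
        (∫ u in (t - 1 / 2)..(t + 1 / 2), ‖A u‖ ^ 2) +
          ∫ u in (t - 1 / 2)..(t + 1 / 2), ‖Q u‖ ^ 2 :=
      intervalIntegral.integral_add ((hcA.norm.pow 2).intervalIntegrable _ _)
        ((hcQ.norm.pow 2).intervalIntegrable _ _)
    have h4 : ∫ u in (t - 1 / 2)..(t + 1 / 2), ‖E u * E u‖ =
        ∫ u in (t - 1 / 2)..(t + 1 / 2), ‖A u‖ ^ 2 :=
      intervalIntegral.integral_congr fun u _ ↦ hEE u
    rw [hEE, h4] at h1
    linarith
  -- sum over the windows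
  have hT0 : 0 ≤ T := by linarith
  have hwA := sum_integral_window_le (g := fun u ↦ ‖A u‖ ^ 2) (hcA.norm.pow 2)
    (fun u ↦ by positivity) hT0 𝒯 h𝒯 hsep
  have hwQ := sum_integral_window_le (g := fun u ↦ ‖Q u‖ ^ 2) (hcQ.norm.pow 2)
    (fun u ↦ by positivity) hT0 𝒯 h𝒯 hsep
  -- the weak integral mean value theorem on `(-(T+1), T+1)`, for `b` and for `b'`
  have hMA : ∫ u in (-(T + 1))..(T + 1), ‖A u‖ ^ 2 ≤ M * S := by
    have h := dirichletPolynomial_meanSquare_le b N (T := T + 1) hT1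
    simpa [hM] using h
  have hb'n : ∀ n ∈ Finset.Icc 1 N, ‖b' n‖ ^ 2 ≤ ‖b n‖ ^ 2 := by
    intro n hn
    by_cases hb0 : b n = 0
    · simp [hb', hb0]
    · have h1 : |c - Real.log n| ≤ 1 := by rw [abs_sub_comm]; exact hc n hn hb0
      have e1 : ‖b' n‖ = ‖b n‖ * |c - Real.log n| := by
        simp only [hb', norm_mul, Complex.norm_real, Complex.norm_I, mul_one, Real.norm_eq_abs]
      rw [e1, mul_pow]
      have h2 : |c - Real.log n| ^ 2 ≤ 1 := by nlinarith [abs_nonneg (c - Real.log n)]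
      nlinarith [sq_nonneg ‖b n‖]
  have hMQ : ∫ u in (-(T + 1))..(T + 1), ‖Q u‖ ^ 2 ≤ M * S := by
    have h := dirichletPolynomial_meanSquare_le b' N (T := T + 1) hT1
    have h' : ∑ n ∈ Finset.Icc 1 N, ‖b' n‖ ^ 2 ≤ S := Finset.sum_le_sum hb'n
    calc ∫ u in (-(T + 1))..(T + 1), ‖Q u‖ ^ 2 ≤ M * ∑ n ∈ Finset.Icc 1 N, ‖b' n‖ ^ 2 := by
          simpa [hM] using h
      _ ≤ M * S := mul_le_mul_of_nonneg_left h' hM0.le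
  -- assemble
  calc ∑ t ∈ 𝒯, ‖A t‖ ^ 2
      ≤ ∑ t ∈ 𝒯, (2 * (∫ u in (t - 1 / 2)..(t + 1 / 2), ‖A u‖ ^ 2) +
          ∫ u in (t - 1 / 2)..(t + 1 / 2), ‖Q u‖ ^ 2) := Finset.sum_le_sum fun t _ ↦ hG t
    _ = 2 * ∑ t ∈ 𝒯, (∫ u in (t - 1 / 2)..(t + 1 / 2), ‖A u‖ ^ 2) +
          ∑ t ∈ 𝒯, ∫ u in (t - 1 / 2)..(t + 1 / 2), ‖Q u‖ ^ 2 := by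
        rw [Finset.sum_add_distrib, Finset.mul_sum]
    _ ≤ 2 * (∫ u in (-(T + 1))..(T + 1), ‖A u‖ ^ 2) +
          ∫ u in (-(T + 1))..(T + 1), ‖Q u‖ ^ 2 := by gcongr
    _ ≤ 2 * (M * S) + M * S := by gcongr
    _ = (3 * M) * S := by ring
    _ ≤ (30 * T + 54 * N) * S := by
        apply mul_le_mul_of_nonneg_right _ hS0
        rw [hM]
        linarith

/-! ### Dyadic decomposition -/

/-- Dyadic partition of unity on `[1, N]`: for `1 ≤ n ≤ N` exactly one `k ≤ ⌊log₂ N⌋` has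
`2^k ≤ n < 2^{k+1}` (namely `k = ⌊log₂ n⌋`). [folklore] -/
theorem sum_range_log_ite_eq {β : Type*} [AddCommMonoid β] {N n : ℕ} (hn : n ∈ Finset.Icc 1 N)
    (x : β) :
    (∑ k ∈ Finset.range (Nat.log 2 N + 1), if 2 ^ k ≤ n ∧ n < 2 ^ (k + 1) then x else 0) = x := by
  rw [Finset.mem_Icc] at hn
  have hn0 : n ≠ 0 := by omega
  have hiff : ∀ k, (2 ^ k ≤ n ∧ n < 2 ^ (k + 1)) ↔ Nat.log 2 n = k := fun k ↦
    (Nat.log_eq_iff (Or.inr ⟨one_lt_two, hn0⟩)).symm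
  simp_rw [hiff]
  exact Finset.sum_ite_eq_of_mem _ _ _
    (Finset.mem_range.2 (Nat.lt_succ_of_le (Nat.log_mono_right hn.2)))

/-- `⌊log₂ N⌋ + 1 ≤ 3 log N` for `N ≥ 2` (as `2^{⌊log₂ N⌋} ≤ N` and `log 2 > 2/3`). [folklore] -/
theorem natLog_two_add_one_le_three_mul_log {N : ℕ} (hN : 2 ≤ N) :
    (Nat.log 2 N : ℝ) + 1 ≤ 3 * Real.log N := by
  have hN2 : (2 : ℝ) ≤ N := by exact_mod_cast hN
  have hpow : (2 : ℝ) ^ Nat.log 2 N ≤ N := by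
    exact_mod_cast Nat.pow_log_le_self 2 (by omega : N ≠ 0)
  have hlog2 : 0 < Real.log 2 := Real.log_pos one_lt_two
  have h1 : (Nat.log 2 N : ℝ) * Real.log 2 ≤ Real.log N := by
    rw [← Real.log_pow]
    exact Real.log_le_log (by positivity) hpow
  have h2 : Real.log 2 ≤ Real.log N := Real.log_le_log two_pos hN2
  have h3 : (0.6931471803 : ℝ) < Real.log 2 := Real.log_two_gt_d9
  have h4 : (0 : ℝ) < (Nat.log 2 N : ℝ) + 1 := by positivity
  nlinarith [mul_pos h4 (by linarith : (0 : ℝ) < Real.log 2 - 2 / 3)]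

/-! ### Ivić's Theorem 5.3 -/

/-- **Discrete mean value theorem for Dirichlet polynomials, Ivić's form with explicit constant**
(PROVED; Ivić 1985, Thm 5.3, (5.14)): for `N ≥ 2`, `T ≥ 1`, a finite set `𝒯 ⊂ [-T, T]` of reals
pairwise `≥ 1` apart and arbitrary complex `a_n`,
`∑_{t ∈ 𝒯} |∑_{n ≤ N} a_n n^{-it}|² ≤ 324 (T ∑_{n ≤ N} |a_n|² + ∑_{n ≤ N} n|a_n|²) log N`.
Proof: dyadic decomposition `A = ∑_{k ≤ ⌊log₂ N⌋} A_k`, Cauchy–Schwarz over the `≤ 3 log N` blocks,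
and the log-free block estimate `sum_norm_sq_dirichletPoly_le_of_abs_log_sub_le` with `c = log 2^k`
(on the block `54 · min(N, 2^{k+1} - 1) ≤ 108 n`). [cite: Ivic1985, Theorem 5.3] -/
theorem sum_norm_sq_dirichletPoly_le_ivic (N : ℕ) (a : ℕ → ℂ) (T : ℝ) (𝒯 : Finset ℝ)
    (hN : 2 ≤ N) (hT : 1 ≤ T) (h𝒯 : ∀ t ∈ 𝒯, |t| ≤ T)
    (hsep : ∀ t ∈ 𝒯, ∀ t' ∈ 𝒯, t ≠ t' → 1 ≤ |t - t'|) :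
    ∑ t ∈ 𝒯, ‖∑ n ∈ Finset.Icc 1 N, a n * (n : ℂ) ^ (-((t : ℂ) * I))‖ ^ 2 ≤
      324 * (T * ∑ n ∈ Finset.Icc 1 N, ‖a n‖ ^ 2 + ∑ n ∈ Finset.Icc 1 N, (n : ℝ) * ‖a n‖ ^ 2)
        * Real.log N := by
  -- notation
  set K : ℕ := Nat.log 2 N with hK
  set blk : ℕ → ℕ → ℂ := fun k n ↦ if 2 ^ k ≤ n ∧ n < 2 ^ (k + 1) then a n else 0 with hblk
  set P : ℕ → ℝ → ℂ := fun k t ↦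
    ∑ n ∈ Finset.Icc 1 N, blk k n * (n : ℂ) ^ (-((t : ℂ) * I)) with hP
  have hT0 : 0 ≤ T := by linarith
  -- Step 1: dyadic decomposition and Cauchy–Schwarz over the blocks
  have hdec : ∀ t : ℝ, ∑ n ∈ Finset.Icc 1 N, a n * (n : ℂ) ^ (-((t : ℂ) * I)) =
      ∑ k ∈ Finset.range (K + 1), P k t := by
    intro t
    simp only [hP]
    rw [Finset.sum_comm]
    refine Finset.sum_congr rfl fun n hn ↦ ?_
    rw [← Finset.sum_mul]
    congr 1
    simp only [hblk]
    exact (sum_range_log_ite_eq hn (a n)).symm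
  have hCS : ∀ t : ℝ, ‖∑ n ∈ Finset.Icc 1 N, a n * (n : ℂ) ^ (-((t : ℂ) * I))‖ ^ 2 ≤
      ((K : ℝ) + 1) * ∑ k ∈ Finset.range (K + 1), ‖P k t‖ ^ 2 := by
    intro t
    rw [hdec t]
    calc ‖∑ k ∈ Finset.range (K + 1), P k t‖ ^ 2
        ≤ (∑ k ∈ Finset.range (K + 1), ‖P k t‖) ^ 2 := by
          gcongr
          exact norm_sum_le _ _
      _ ≤ #(Finset.range (K + 1)) * ∑ k ∈ Finset.range (K + 1), ‖P k t‖ ^ 2 :=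
          sq_sum_le_card_mul_sum_sq
      _ = ((K : ℝ) + 1) * ∑ k ∈ Finset.range (K + 1), ‖P k t‖ ^ 2 := by
          rw [Finset.card_range]
          push_cast
          ring
  -- Step 2: the log-free estimate for each block
  have hblock : ∀ k ∈ Finset.range (K + 1), ∑ t ∈ 𝒯, ‖P k t‖ ^ 2 ≤
      ∑ n ∈ Finset.Icc 1 N, (30 * T + 108 * n) * ‖blk k n‖ ^ 2 := by
    intro k _
    set N' : ℕ := min N (2 ^ (k + 1) - 1) with hN'
    have hpow : 2 ^ (k + 1) = 2 * 2 ^ k := by rw [pow_succ, mul_comm]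
    have hsub : Finset.Icc 1 N' ⊆ Finset.Icc 1 N := Finset.Icc_subset_Icc_right (min_le_left _ _)
    have hzero : ∀ n ∈ Finset.Icc 1 N, n ∉ Finset.Icc 1 N' → blk k n = 0 := by
      intro n hn hn'
      simp only [Finset.mem_Icc, not_and, not_le] at hn hn'
      have hlt : N' < n := hn' hn.1
      simp only [hblk]
      rw [if_neg]
      rintro ⟨-, h2⟩
      have : n ≤ N' := by rw [hN']; exact le_min hn.2 (by omega)
      omega
    have hPk : ∀ t, P k t = ∑ n ∈ Finset.Icc 1 N', blk k n * (n : ℂ) ^ (-((t : ℂ) * I)) := by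
      intro t
      simp only [hP]
      rw [← Finset.sum_subset hsub]
      intro n hn hn'
      rw [hzero n hn hn', zero_mul]
    -- the frequencies of the block lie within `1` of `c = log 2^k`
    have hc : ∀ n ∈ Finset.Icc 1 N', blk k n ≠ 0 →
        |Real.log n - Real.log ((2 : ℝ) ^ k)| ≤ 1 := by
      intro n _ hne
      have hcond : 2 ^ k ≤ n ∧ n < 2 ^ (k + 1) := by
        by_contra hcon
        exact hne (if_neg hcon)
      obtain ⟨h1, h2⟩ := hcond
      have h1' : (2 : ℝ) ^ k ≤ n := by exact_mod_cast h1
      have h2' : (n : ℝ) < 2 ^ (k + 1) := by exact_mod_cast h2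
      have hpos : (0 : ℝ) < 2 ^ k := by positivity
      have hlo : Real.log ((2 : ℝ) ^ k) ≤ Real.log n := Real.log_le_log hpos h1'
      have hhi : Real.log n < Real.log ((2 : ℝ) ^ (k + 1)) := Real.log_lt_log (by linarith) h2'
      rw [pow_succ, Real.log_mul hpos.ne' two_ne_zero] at hhi
      rw [abs_of_nonneg (by linarith)]
      linarith [Real.log_two_lt_d9]
    have hB := sum_norm_sq_dirichletPoly_le_of_abs_log_sub_le N' (blk k) (Real.log ((2 : ℝ) ^ k))
      hc hT 𝒯 h𝒯 hsep
    simp_rw [hPk]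
    refine hB.trans ?_
    rw [Finset.mul_sum, ← Finset.sum_subset hsub (fun n hn hn' ↦ by rw [hzero n hn hn']; simp)]
    refine Finset.sum_le_sum fun n _ ↦ ?_
    by_cases h0 : blk k n = 0
    · simp [h0]
    · have hcond : 2 ^ k ≤ n ∧ n < 2 ^ (k + 1) := by
        by_contra hcon
        exact h0 (if_neg hcon)
      have hN'le : (N' : ℝ) ≤ 2 * n := by
        have h1 : N' ≤ 2 ^ (k + 1) - 1 := min_le_right _ _
        have h2 : N' ≤ 2 * n := by omega
        exact_mod_cast h2
      have hle : 30 * T + 54 * (N' : ℝ) ≤ 30 * T + 108 * n := by linarith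
      exact mul_le_mul_of_nonneg_right hle (by positivity)
  -- Step 3: recombine the blocks
  have hkey : ∀ n ∈ Finset.Icc 1 N, ∑ k ∈ Finset.range (K + 1), ‖blk k n‖ ^ 2 = ‖a n‖ ^ 2 := by
    intro n hn
    have h1 : ∀ k, ‖blk k n‖ ^ 2 = if 2 ^ k ≤ n ∧ n < 2 ^ (k + 1) then ‖a n‖ ^ 2 else 0 := by
      intro k
      simp only [hblk]
      split_ifs <;> simp
    simp_rw [h1]
    exact sum_range_log_ite_eq hn _
  have hS0 : 0 ≤ ∑ n ∈ Finset.Icc 1 N, ‖a n‖ ^ 2 := Finset.sum_nonneg fun n _ ↦ by positivity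
  have hS1 : 0 ≤ ∑ n ∈ Finset.Icc 1 N, (n : ℝ) * ‖a n‖ ^ 2 :=
    Finset.sum_nonneg fun n _ ↦ by positivity
  have hK3 : (K : ℝ) + 1 ≤ 3 * Real.log N := natLog_two_add_one_le_three_mul_log hN
  have hlogN : 0 ≤ Real.log N := Real.log_nonneg (by exact_mod_cast (by omega : 1 ≤ N))
  calc ∑ t ∈ 𝒯, ‖∑ n ∈ Finset.Icc 1 N, a n * (n : ℂ) ^ (-((t : ℂ) * I))‖ ^ 2
      ≤ ∑ t ∈ 𝒯, (((K : ℝ) + 1) * ∑ k ∈ Finset.range (K + 1), ‖P k t‖ ^ 2) :=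
        Finset.sum_le_sum fun t _ ↦ hCS t
    _ = ((K : ℝ) + 1) * ∑ k ∈ Finset.range (K + 1), ∑ t ∈ 𝒯, ‖P k t‖ ^ 2 := by
        rw [← Finset.mul_sum, Finset.sum_comm]
    _ ≤ ((K : ℝ) + 1) * ∑ k ∈ Finset.range (K + 1),
          ∑ n ∈ Finset.Icc 1 N, (30 * T + 108 * n) * ‖blk k n‖ ^ 2 := by
        gcongr with k hk
        exact hblock k hk
    _ = ((K : ℝ) + 1) * ∑ n ∈ Finset.Icc 1 N, (30 * T + 108 * n) * ‖a n‖ ^ 2 := by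
        congr 1
        rw [Finset.sum_comm]
        refine Finset.sum_congr rfl fun n hn ↦ ?_
        rw [← Finset.mul_sum, hkey n hn]
    _ = ((K : ℝ) + 1) * (30 * (T * ∑ n ∈ Finset.Icc 1 N, ‖a n‖ ^ 2) +
          108 * ∑ n ∈ Finset.Icc 1 N, (n : ℝ) * ‖a n‖ ^ 2) := by
        congr 1
        rw [Finset.mul_sum, Finset.mul_sum, Finset.mul_sum, ← Finset.sum_add_distrib]
        exact Finset.sum_congr rfl fun n _ ↦ by ring
    _ ≤ (3 * Real.log N) * (108 * (T * ∑ n ∈ Finset.Icc 1 N, ‖a n‖ ^ 2 +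
          ∑ n ∈ Finset.Icc 1 N, (n : ℝ) * ‖a n‖ ^ 2)) := by
        apply mul_le_mul hK3 _ (by positivity) (by positivity)
        nlinarith [mul_nonneg hT0 hS0]
    _ = 324 * (T * ∑ n ∈ Finset.Icc 1 N, ‖a n‖ ^ 2 +
          ∑ n ∈ Finset.Icc 1 N, (n : ℝ) * ‖a n‖ ^ 2) * Real.log N := by ring

/-- **Ivić 1985, Theorem 5.3 holds** (the named fact
`Literature.NumberTheory.LFunctions.Ivic1985_theorem53` of `DirichletPolynomialMeanValue.lean`,
with `C = 324`): for `N ≥ 2`, `T ≥ 1`, a finite set `𝒯 ⊂ [1, T]` of reals pairwise `≥ 1` apart,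
`∑_{t ∈ 𝒯} |∑_{n ≤ N} a_n n^{-it}|² ≤ C (T ∑ |a_n|² + ∑ n|a_n|²) log N`.
[cite: Ivic1985, Theorem 5.3] -/
theorem Ivic1985_theorem53_holds : Ivic1985_theorem53 := by
  refine ⟨324, fun N a T 𝒯 hN hT h𝒯 hsep ↦ ?_⟩
  have h𝒯' : ∀ t ∈ 𝒯, |t| ≤ T := fun t ht ↦ by
    obtain ⟨h1, h2⟩ := h𝒯 t ht
    rwa [abs_of_nonneg (by linarith)]
  exact sum_norm_sq_dirichletPoly_le_ivic N a T 𝒯 hN hT h𝒯' hsep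

end Literature.NumberTheory.LFunctions
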